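import Summits.BirchSwinnertonDyer.BirchSwinnertonDyer.Theorems.SmallImageMuTransferAnalyticMuZeroX9TeichSpanDefs
import HarnessLib

/-!
# Route `SignedLowerHalves`, crux `KobayashiMainConjectureSmallImage` (item stmt-BirchSwinnertonDyer-19002), line `birth_acns`,
# stub `stub_muOneSign_ns_ge5`: **LEVEL DESCENT and COFINALITY for CONJ B⁰ (`TeichSpanGen`)** — importable tree copy
# (cell `bsd-ssimc`, seat `bsd-line-slh-p3` gen 9, LEAD; THEOREMS ONLY; helper `--supports stmt-BirchSwinnertonDyer-19002`)

PROVENANCE: mathematics and Lean text by the ideator `bsd-idea-13` gen 11 (crux workfile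
`Cruxes/KobayashiMainConjectureSmallImage/TeichSpanLevelDescent_g11.lean` v2, sha256 a63e69ff347e…; rc 0 / 0 sorry / 0 warning),
landed VERBATIM by the line's LEAD (planners do not land `Theorems/`; crux modules are not importable from `Theorems/`) under the
namespace `…Theorems.SmallImageTeichSpanLevelDescent`, so that (i) the per-level form of the line's one-sign `μ`-rider
(`Theorems/…SmallImageTeichOrbitMuLevel.lean`, this seat) can take B⁰ at ANY ONE multiple of the conductor prime to `p`, and (ii) cell
`bsd-f3-mu`'s attack on `stub_teichSpanGenAll` (crux 19630 LINE C) may assume `4 ∣ N` importably.  Context: since 2026-08-28T15:29Z the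
`p ≥ 5` rider `stub_muOneSign_ns_ge5` is a kernel consequence of `TeichSpanGenAll` (`…SmallImageTeichOrbitMu.lean`, p645198).

WHAT THIS FILE PROVES (sorry-free; group theory of `Γ₀(N)` only; nothing about any curve or form):
* `teichSpanGen_of_dvd` — **level descent**: `N ∣ N'`, `p ∤ N'` ⊢ `TeichSpanGen N' p → TeichSpanGen N p` (a good `γ ∈ Γ₀(N)`
  factors as `γ'·L`, `γ' ∈ Γ₀(N')` with the SAME second column — Bezout on `gcd(d, b·N') = 1` — and `L` unipotent of trace `2`;
  generators and commutators push forward along `Γ₀(N') ≤ Γ₀(N)`; `x y x^ι y^ι = (x x^ι)·⁅(x^ι)⁻¹, y⁆·y·y^ι`).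
* `teichSpanGenAll_iff_forall_mul` — **cofinality** for any auxiliary modulus prime to `p`; instances `…_dvd_thirtySix`, `…_auxPrime_dvd`
  (and `…_dvd_four` in the sequel).
* (sequel `…TeichSpanLevelDescentFourDvd.lean`: at `4 ∣ N`, `Γ₀(N)` has no elliptic elements, so on the cofinal family `4 ∣ N` the
  generator set is «packets ∪ trace ±2 ∪ p-th powers» and `TeichSpanGenAll ↔` B⁰ on `4 ∣ N`.)
HONEST FRAMING: `TeichSpanGenAll` / B⁰ stays OPEN (it contains Perrin-Riou's conjecture `μ^±(f,ω⁰) = 0`, Pollack–Weston 2011 Thm. 4.1 /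
Rem. 4.2, at every level); this file proves an implication between its instances only.  Crux 19002 stays OPEN; BSD is not proved by any of
this; no summit statement is proved by this seat.
References: [Manin1972] Prop. 1.4; [Sun2007] §4; [DiamondShurman2005] Prop. 2.3.3, §3.7–3.8; [Freitag1990] Ch. I Remark 1.5.
-/

-- D-0017: single-problem summit, the namespace repeats the problem name by design.
set_option linter.dupNamespace false
set_option autoImplicit false

noncomputable section

open scoped Classical MatrixGroups commutatorElement
open CongruenceSubgroup
open Literature.NumberTheory.EllipticCurves.Rank1Residual
open Summit.BirchSwinnertonDyer.BirchSwinnertonDyer.Cruxes.AnalyticMuZeroX9.TeichSpan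

namespace Summit.BirchSwinnertonDyer.BirchSwinnertonDyer.Theorems.SmallImageTeichSpanLevelDescent

variable {N N' : ℕ}

/-! ### §1 The inclusion `Γ₀(N') ≤ Γ₀(N)` for `N ∣ N'` and what it preserves -/

/-- `N ∣ N' → Γ₀(N') ≤ Γ₀(N)`. [folklore] -/
theorem gamma0_le_of_dvd (h : N ∣ N') : Gamma0 N' ≤ Gamma0 N := by
  intro γ hγ
  rw [Gamma0_mem] at hγ ⊢
  rw [ZMod.intCast_zmod_eq_zero_iff_dvd] at hγ ⊢
  exact (Int.natCast_dvd_natCast.mpr h).trans hγ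

/-- `incl` does not change the underlying `SL₂(ℤ)` matrix. [folklore] -/
@[simp] theorem coe_incl (h : N ∣ N') (γ : Gamma0 N') :
    ((Subgroup.inclusion (gamma0_le_of_dvd h) γ : Gamma0 N) : SL(2, ℤ)) = (γ : SL(2, ℤ)) := rfl

/-- `incl` preserves the `d`-entry. [folklore] -/
@[simp] theorem dEntry_incl (h : N ∣ N') (γ : Gamma0 N') : dEntry (Subgroup.inclusion (gamma0_le_of_dvd h) γ) = dEntry γ := rfl

/-- `incl` preserves the `b`-entry. [folklore] -/
@[simp] theorem bEntry_incl (h : N ∣ N') (γ : Gamma0 N') : bEntry (Subgroup.inclusion (gamma0_le_of_dvd h) γ) = bEntry γ := rfl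

/-- `incl` preserves the trace. [folklore] -/
@[simp] theorem trEntry_incl (h : N ∣ N') (γ : Gamma0 N') : trEntry (Subgroup.inclusion (gamma0_le_of_dvd h) γ) = trEntry γ := rfl

/-- `incl` commutes with the `ι`-involution. [cite: Manin1972, Prop. 1.4] -/
theorem incl_iotaGamma0 (h : N ∣ N') (γ : Gamma0 N') :
    Subgroup.inclusion (gamma0_le_of_dvd h) (iotaGamma0 γ) = iotaGamma0 (Subgroup.inclusion (gamma0_le_of_dvd h) γ) :=
  Subtype.ext rfl

/-- `incl` preserves goodness (`|d| = pᵐ`). [cite: Sun2007, §4] -/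
theorem isGoodAt_incl (h : N ∣ N') {p : ℕ} {γ : Gamma0 N'} (hγ : IsGoodAt p γ) :
    IsGoodAt p (Subgroup.inclusion (gamma0_le_of_dvd h) γ) := hγ

/-- `ι` is multiplicative on `SL₂(ℤ)` (it is conjugation by `diag(-1,1)`). [cite: Manin1972, Prop. 1.4] -/
theorem iotaSL_mul (x y : SL(2, ℤ)) : iotaSL (x * y) = iotaSL x * iotaSL y := by
  ext i j
  fin_cases i <;> fin_cases j <;>
    simp [iotaSL, Matrix.mul_apply, Fin.sum_univ_two] <;> ring

/-- `ι` is multiplicative on `Γ₀(N)`. [cite: Manin1972, Prop. 1.4] -/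
theorem iotaGamma0_mul (x y : Gamma0 N) : iotaGamma0 (x * y) = iotaGamma0 x * iotaGamma0 y :=
  Subtype.ext <| by simp only [coe_iotaGamma0, Subgroup.coe_mul, iotaSL_mul]

/-- Teichmüller packets of `Γ₀(N')` are Teichmüller packets of `Γ₀(N)`. [cite: Manin1972, Prop. 1.4] -/
theorem isTeichPacket_map_incl (h : N ∣ N') {p n : ℕ} {l : List (Gamma0 N')} (hl : IsTeichPacket N' p n l) :
    IsTeichPacket N p n (l.map (Subgroup.inclusion (gamma0_le_of_dvd h))) := by
  obtain ⟨hlen, hd, hnodup, c, hc⟩ := hl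
  refine ⟨by simpa using hlen, ?_, ?_, c, ?_⟩
  · intro g hg
    obtain ⟨g', hg', rfl⟩ := List.mem_map.mp hg
    exact hd g' hg'
  · rw [List.map_map]
    exact hnodup
  · intro g hg
    obtain ⟨g', hg', rfl⟩ := List.mem_map.mp hg
    exact hc g' hg'

/-- The generators of `Γ₀(N')` push forward to generators of `Γ₀(N)`. [cite: Manin1972, Prop. 1.4] -/
theorem incl_mem_teichSpanGenerators (h : N ∣ N') {p : ℕ} {γ : Gamma0 N'}
    (hγ : γ ∈ teichSpanGenerators N' p) : Subgroup.inclusion (gamma0_le_of_dvd h) γ ∈ teichSpanGenerators N p := by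
  simp only [teichSpanGenerators, teichPacketProducts, Set.mem_union, Set.mem_setOf_eq] at hγ
  rcases hγ with ((⟨n, l, hn, hl, rfl⟩ | hfin | htr) | ⟨h', rfl⟩)
  · rw [map_list_prod]
    exact prod_mem_teichSpanGenerators hn (isTeichPacket_map_incl h hl)
  · exact mem_teichSpanGenerators_of_isOfFinOrder ((Subgroup.inclusion (gamma0_le_of_dvd h)).isOfFinOrder hfin)
  · exact mem_teichSpanGenerators_of_trEntry htr
  · rw [map_pow]
    exact pow_mem_teichSpanGenerators _

/-- `⟨generators⟩·[Γ₀(N'),Γ₀(N')]` pushes forward into `⟨generators⟩·[Γ₀(N),Γ₀(N)]`. [cite: Manin1972, Prop. 1.4] -/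
theorem map_closure_sup_commutator_le (h : N ∣ N') (p : ℕ) :
    (Subgroup.closure (teichSpanGenerators N' p) ⊔ commutator (Gamma0 N')).map (Subgroup.inclusion (gamma0_le_of_dvd h)) ≤
      Subgroup.closure (teichSpanGenerators N p) ⊔ commutator (Gamma0 N) := by
  rw [Subgroup.map_sup]
  apply sup_le_sup
  · rw [MonoidHom.map_closure]
    apply Subgroup.closure_mono
    rintro _ ⟨γ, hγ, rfl⟩
    exact incl_mem_teichSpanGenerators h hγ
  · rw [commutator_def, commutator_def, Subgroup.map_commutator]
    exact Subgroup.commutator_mono le_top le_top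

/-! ### §2 Same-second-column factorisation `γ = γ'·L` (`γ' ∈ Γ₀(N')`, `L` unipotent) -/

/-- For `N ∣ N'`, `p ∤ N'` and a good `γ = (a b; c d) ∈ Γ₀(N)` (`|d| = pᵐ`): there is `γ' ∈ Γ₀(N')` with the same
second column `(b, d)` (so `γ'` is good) and a trace-`2` element `L = (1 0; t 1) ∈ Γ₀(N)` with `γ = γ'·L`.
(Bezout on `gcd(d, b·N') = 1`.) [cite: Sun2007, §4] -/
theorem exists_eq_incl_mul_of_isGoodAt (h : N ∣ N') {p : ℕ} (hp : p.Prime) (hpN' : ¬ p ∣ N')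
    {γ : Gamma0 N} (hγ : IsGoodAt p γ) :
    ∃ (γ' : Gamma0 N') (L : Gamma0 N), IsGoodAt p γ' ∧ trEntry L = 2 ∧ γ = Subgroup.inclusion (gamma0_le_of_dvd h) γ' * L := by
  obtain ⟨m, hm⟩ := hγ
  -- names for the entries of γ
  set g : Matrix (Fin 2) (Fin 2) ℤ := ((γ : SL(2, ℤ)) : Matrix (Fin 2) (Fin 2) ℤ) with hg_def
  have hdet : g 0 0 * g 1 1 - g 0 1 * g 1 0 = 1 := by
    have := (γ : SL(2, ℤ)).det_coe
    rw [Matrix.det_fin_two] at this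
    exact this
  have hγ10 : (N : ℤ) ∣ g 1 0 := (ZMod.intCast_zmod_eq_zero_iff_dvd _ _).mp (Gamma0_mem.mp γ.2)
  have hNN' : (N : ℤ) ∣ (N' : ℤ) := Int.natCast_dvd_natCast.mpr h
  -- gcd(d, b N') = 1
  have hdb : IsCoprime (g 1 1) (g 0 1) := ⟨g 0 0, -g 1 0, by linear_combination hdet⟩
  have hdN' : IsCoprime (g 1 1) (N' : ℤ) := by
    rw [Int.isCoprime_iff_gcd_eq_one]
    show Nat.gcd (g 1 1).natAbs (N' : ℤ).natAbs = 1
    have hm' : (g 1 1).natAbs = p ^ m := hm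
    rw [hm', Int.natAbs_natCast]
    exact Nat.Coprime.pow_left m ((Nat.Prime.coprime_iff_not_dvd hp).mpr hpN')
  obtain ⟨x, y, hxy⟩ := hdb.mul_right hdN'
  -- γ' := (x b; -y N' d) ∈ Γ₀(N')
  let γ'SL : SL(2, ℤ) := ⟨!![x, g 0 1; -(y * N'), g 1 1], by
    rw [Matrix.det_fin_two_of]; linear_combination hxy⟩
  have hγ'mem : γ'SL ∈ Gamma0 N' := by
    rw [Gamma0_mem]
    show (((-(y * (N' : ℤ)) : ℤ) : ZMod N') = 0)
    rw [ZMod.intCast_zmod_eq_zero_iff_dvd]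
    exact (dvd_mul_left (N' : ℤ) y).neg_right
  -- L := (1 0; t 1) ∈ Γ₀(N), t = y N' a + x c
  let t : ℤ := y * N' * g 0 0 + x * g 1 0
  have ht : (N : ℤ) ∣ t :=
    dvd_add (dvd_mul_of_dvd_left (dvd_mul_of_dvd_right hNN' y) _) (dvd_mul_of_dvd_right hγ10 x)
  let LSL : SL(2, ℤ) := ⟨!![1, 0; t, 1], by rw [Matrix.det_fin_two_of]; ring⟩
  have hLmem : LSL ∈ Gamma0 N := by
    rw [Gamma0_mem]
    show ((t : ℤ) : ZMod N) = 0
    rw [ZMod.intCast_zmod_eq_zero_iff_dvd]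
    exact ht
  refine ⟨⟨γ'SL, hγ'mem⟩, ⟨LSL, hLmem⟩, ⟨m, hm⟩, ?_, ?_⟩
  · show (1 : ℤ) + 1 = 2
    norm_num
  · -- the matrix identity γ = γ'·L, from `hdet` and `hxy`
    apply Subtype.ext
    rw [Subgroup.coe_mul, coe_incl h]
    ext i j
    rw [Matrix.SpecialLinearGroup.coe_mul]
    fin_cases i <;> fin_cases j
    · show g 0 0 = (!![x, g 0 1; -(y * N'), g 1 1] * !![1, 0; t, 1]) 0 0
      simp [Matrix.mul_apply, Fin.sum_univ_two, t]
      linear_combination (-(g 0 0)) * hxy + x * hdet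
    · show g 0 1 = (!![x, g 0 1; -(y * N'), g 1 1] * !![1, 0; t, 1]) 0 1
      simp [Matrix.mul_apply, Fin.sum_univ_two]
    · show g 1 0 = (!![x, g 0 1; -(y * N'), g 1 1] * !![1, 0; t, 1]) 1 0
      simp [Matrix.mul_apply, Fin.sum_univ_two, t]
      linear_combination (-(g 1 0)) * hxy + (-(y * N')) * hdet
    · show g 1 1 = (!![x, g 0 1; -(y * N'), g 1 1] * !![1, 0; t, 1]) 1 1
      simp [Matrix.mul_apply, Fin.sum_univ_two]

/-! ### §3 Level descent and cofinality -/

/-- **LEVEL DESCENT for B⁰.** For `N ∣ N'` and `p ∤ N'`: `TeichSpanGen N' p → TeichSpanGen N p`.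
[cite: Manin1972, Prop. 1.4] [cite: Sun2007, §4] -/
theorem teichSpanGen_of_dvd (h : N ∣ N') {p : ℕ} (hp : p.Prime) (hpN' : ¬ p ∣ N')
    (hB : TeichSpanGen N' p) : TeichSpanGen N p := by
  intro γ hγ
  obtain ⟨γ', L, hγ', hL, rfl⟩ := exists_eq_incl_mul_of_isGoodAt h hp hpN' hγ
  set S := Subgroup.closure (teichSpanGenerators N p) ⊔ commutator (Gamma0 N) with hS_def
  have hx : Subgroup.inclusion (gamma0_le_of_dvd h) γ' * iotaGamma0 (Subgroup.inclusion (gamma0_le_of_dvd h) γ') ∈ S := by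
    have h1 := hB γ' hγ'
    have h2 : Subgroup.inclusion (gamma0_le_of_dvd h) (γ' * iotaGamma0 γ') ∈ S :=
      map_closure_sup_commutator_le h p (Subgroup.mem_map_of_mem (Subgroup.inclusion (gamma0_le_of_dvd h)) h1)
    rwa [map_mul, incl_iotaGamma0 h] at h2
  have hy : L ∈ S :=
    Subgroup.mem_sup_left (Subgroup.subset_closure (mem_teichSpanGenerators_of_trEntry (Or.inl hL)))
  have hy' : iotaGamma0 L ∈ S :=
    Subgroup.mem_sup_left (Subgroup.subset_closure
      (mem_teichSpanGenerators_of_trEntry (Or.inl (by rw [trEntry_iotaGamma0]; exact hL))))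
  have hc : ⁅(iotaGamma0 (Subgroup.inclusion (gamma0_le_of_dvd h) γ'))⁻¹, L⁆ ∈ S :=
    Subgroup.mem_sup_right (Subgroup.commutator_mem_commutator (Subgroup.mem_top _) (Subgroup.mem_top _))
  rw [iotaGamma0_mul]
  have key : Subgroup.inclusion (gamma0_le_of_dvd h) γ' * L * (iotaGamma0 (Subgroup.inclusion (gamma0_le_of_dvd h) γ') * iotaGamma0 L)
      = (Subgroup.inclusion (gamma0_le_of_dvd h) γ' * iotaGamma0 (Subgroup.inclusion (gamma0_le_of_dvd h) γ')) *
          ⁅(iotaGamma0 (Subgroup.inclusion (gamma0_le_of_dvd h) γ'))⁻¹, L⁆ * L * iotaGamma0 L := by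
    simp only [commutatorElement_def]; group
  rw [key]
  exact Subgroup.mul_mem _ (Subgroup.mul_mem _ (Subgroup.mul_mem _ hx hc) hy) hy'

/-- **COFINALITY.** For any auxiliary modulus `M p` prime to `p` (`p ≥ 5`): B⁰ at all levels prime to `p` is
equivalent to B⁰ at the levels prime to `p` that are divisible by `M p`. [cite: Manin1972, Prop. 1.4] -/
theorem teichSpanGenAll_iff_forall_mul (M : ℕ → ℕ) (hM : ∀ p : ℕ, p.Prime → 5 ≤ p → ¬ p ∣ M p) :
    TeichSpanGenAll ↔
      ∀ (N p : ℕ), p.Prime → 5 ≤ p → ¬ p ∣ N → M p ∣ N → TeichSpanGen N p := by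
  constructor
  · intro hB N p hp h5 hpN _
    exact hB N p hp h5 hpN
  · intro hB N p hp h5 hpN
    have hpMN : ¬ p ∣ M p * N := by
      intro hdvd
      rcases (Nat.Prime.dvd_mul hp).mp hdvd with h1 | h2
      · exact hM p hp h5 h1
      · exact hpN h2
    exact teichSpanGen_of_dvd (Dvd.intro_left _ rfl) hp hpMN (hB (M p * N) p hp h5 hpMN (Dvd.intro _ rfl))

/-- **COFINALITY at `36 ∣ N`** (no elliptic elements in `Γ₀(N)`: `a² ≡ -1 (mod 4)` and `a² - a + 1 ≡ 0 (mod 9)` are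
insoluble, so the finite-order generators are `±1` and `Γ₀(N)/±1` is free):
`TeichSpanGenAll ↔ ∀ N p, p prime, 5 ≤ p, p ∤ N, 36 ∣ N → TeichSpanGen N p`. [cite: Manin1972, Prop. 1.4] -/
theorem teichSpanGenAll_iff_forall_dvd_thirtySix :
    TeichSpanGenAll ↔
      ∀ (N p : ℕ), p.Prime → 5 ≤ p → ¬ p ∣ N → 36 ∣ N → TeichSpanGen N p := by
  refine teichSpanGenAll_iff_forall_mul (fun _ => 36) ?_
  intro p hp h5 hd
  have h36 : p ∣ 36 := hd
  have hle : p ≤ 36 := Nat.le_of_dvd (by norm_num) h36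
  interval_cases p <;> first | (norm_num at h36; done) | norm_num at hp

/-- **COFINALITY with an auxiliary prime in the level**: for any choice of primes `q p ≠ p`,
`TeichSpanGenAll ↔ ∀ N p, p prime, 5 ≤ p, p ∤ N, q p ∣ N → TeichSpanGen N p`. [cite: Manin1972, Prop. 1.4] -/
theorem teichSpanGenAll_iff_forall_auxPrime_dvd (q : ℕ → ℕ) (hq : ∀ p, (q p).Prime) (hqp : ∀ p, q p ≠ p) :
    TeichSpanGenAll ↔
      ∀ (N p : ℕ), p.Prime → 5 ≤ p → ¬ p ∣ N → q p ∣ N → TeichSpanGen N p := by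
  refine teichSpanGenAll_iff_forall_mul q ?_
  intro p hp _ hd
  exact hqp p ((Nat.prime_dvd_prime_iff_eq hp (hq p)).mp hd).symm

end Summit.BirchSwinnertonDyer.BirchSwinnertonDyer.Theorems.SmallImageTeichSpanLevelDescent

end
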